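import Summits.ABC.IUTFork.Repair.RHLinearReachLawExact
import Summits.ABC.IUTFork.Repair.RHLevelMoverBoxFree
import Summits.ABC.IUTFork.Repair.RHSlotReach
import HarnessLib

/-!
# D-0079 RESCUE sub-cell R-H, row 20 `linear-reach-law` — `RHLinearReachLawDoor` (ROUND-2 KERNEL LINK «H⋆₂₀ ⟹ hull»):
# the datum-level cells `CellReachAt` / `CellAt` (and the candidates `HStarReach` / `HStar`) ⟹ `qRegion (i+1) p ⊆ ⁿ˒°𝒰_{i+1,p}`
# at `settingPrVolSharp`, at every ONE-PLACE bad packet, for ideles HONESTLY REALISING the pilot divisors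

PROOF-ONLY composition file (D-0012: 0 definitions, 0 `Prop` facts; abc-iut cell, rung LADDER-ABC:A2.RESCUE.H; seat abc-iut-rh-typ-7 gen 3 = R-H ROUND 1
PAIR n = 7 TYPER of rows 7 and 20). WHY: row 20's round-1 word is «KILL(k1) pooled + WINDOW-LOCATOR(HEX slice)» (`plan/rescue/R-H/ROUND1.tsv` FINAL), with
the lead's reading of record (2026-08-26T19:59:53Z) «KEEP-on-slice upgrade → round 2 once H⋆₂₀ ⟹ hull is in kernel». abc-iut-rp-d3 landed the box-free door
for the author's integer cell, `RHLevelMover.qRegion_subset_thetaHull_settingPrVolSharp_of_reachCell` (p465556: `ReachCell e c B (i+1) m` + a ONE-PLACE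
DICTIONARY `(ϖ, y, z, ‖t_q‖ = ‖ϖ‖^m, ‖t_Θ‖ = ‖ϖ‖^{(i+1)²m})` ⟹ the inclusion). THIS FILE discharges that dictionary from the TREE'S OWN OBJECTS, so that
the link starts at row 20's DECIDING declarations (`RH.LinearReachLaw.CellReachAt` / `HStarReach`, p465403; `CellAt` / `HStar`, p464190) and at the
setting's STANDARD side conditions:

* `e := e(x₀|p)`; `ϖ :=` abc-iut-c312-7's norm uniformizer `Thm311.Real.unifOf X p x₀` of `K_{x₀}`, `‖ϖ‖ = p^{−1/e}` (`norm_unifOf`;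
  the cell quantifies over EVERY norm uniformizer, so one suffices); `c, B :=` THE inner conductor / outer order of `log_p(𝒪_{x₀}^×)` (`exists_isInnerConductor`,
  `exists_isOuterOrder`, p463810); `y :=` the conductor's minimality witness (`‖y‖ ≤ ‖ϖ‖^{c−1}`, `y ∉ log_p 𝒪^×`; `c ≥ 1` by abc-iut-rh-typ-12's
  `RHSlotReach.exists_norm_le_one_not_mem_logUnits`, [IUTchIV] Prop. 1.4 (ii)); `z :=` the outer order's witness (`‖z‖ = ‖ϖ‖^B`);
* the realising norms `‖t_{q,x₀}‖ = ‖ϖ‖^m`, `‖t_{Θ,i+1,x₀}‖ = ‖ϖ‖^{(i+1)²m}` from the HONEST side conditions of the `K`-level certificates —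
  `log ‖t_q‖ = −P_q·log N/n`, `log ‖t_Θ‖ = −P_{Θ,j}·log N/n` (the `ht`/`htq` binders of `Cor312Prov.exists_realising_qIdeles_of_twoMulLDvdOrdq`) —
  via abc-iut's `EvalI06StarGenuine.norm_qIdele_eq_rpow_of_realises` / `norm_thetaIdele_eq_rpow_of_realises`, and `2l ∣ ord_{x₀}(q)`
  (`Cor312Prov.TwoMulLDvdOrdq X`; a THEOREM at the genuine datum, `Cor312Prov.twoMulLDvdOrdq_pilotDataOfK`, [IUTchI] Ex. 3.2 (iv)).

WHAT IS PROVED (namespace `Summit.ABC.IUTFork.Repair.RH.LinearReachLaw`):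
* §0 `one_le_of_isInnerConductor`, `exists_not_mem_logUnits_of_isInnerConductor` — the inner conductor is `≥ 1` and is WITNESSED one step below.
* §1 `qRegion_subset_thetaHull_settingPrVolSharp_of_cellReachAt` — at a prime `p` carrying a UNIQUE place `x₀` of `F` (`huniq`) which is bad,
  label `i+1`: the EXACT cell `CellReachAt X p i x₀` ⟹ `qRegion (i+1) p ⊆ thetaHull (i+1) p` (realising ideles, `2l ∣ ord_{x₀}(q)`);
  `…_of_cellAt` — the same from H⋆₂₀'s envelope cell (`cellReachAt_of_cellAt`); `…_of_hStarReach` / `…_of_hStar` — the datum-level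
  candidates give the inclusion at EVERY one-place bad packet; `…_of_hStarReach_of_twoMulLDvdOrdq` with the divisibility by name.
* §2 the same at print's own `K`-level datum `Cor312Prov.pilotDataOfK D K`, divisibility DISCHARGED: `…_pilotDataOfK_of_cellReachAt` /
  `…_pilotDataOfK_of_hStarReach` / `…_pilotDataOfK_of_hStar`.
* §3 Σ₂₀ DECIDED at the genuine bed (untied rows): `cellReachAt_pilotDataOfK_iff_col_of_not_dvd` (the exact cell IS the column cell
  `ReachCell2l e_x r_in_ub r_out_sharp (i+1) (e(x|v)·ord_v(q_v)) l`), `not_hStarReach_pilotDataOfK_of_not_col` (column-NEG ⇒ off Σ₂₀).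

HONEST SCOPE. PACKET-LOCAL: the stratum served is Σ₂₀ ⊆ {one-place bad packets `(p, i+1)` whose cell holds} — round 2's «S_H restricted to Σ
through a landed door» currency (abc-iut-rp-d3 `RHSlotReachLocal`, p465892); NOT a global hSHw (split primes have no `huniq`; row 20 says nothing there).
k1 of the exact cell (I06STAR-COLUMNS v1): pooled 55.1 %, HEX-strip slices `k ≤ k₀(l, type)` (`RHLinearReachLawExact`) — a WINDOW-LOCATOR's door, not a
rescue. OUR typed (Ind2) (Dupuy–Hilado, STRONGER-THAN-PRINT), SHARP boxes, Step (xi-f) at hull level. TAKES NO SIDE on [IUTchIII] Cor. 3.12 or on any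
author; the cells are HYPOTHESES (claim-tagged defs of p464190/p465403), never asserted; typed ≠ proved; instantiated ≠ endorsed. [cite: Mochizuki2012,
IUTchI Ex. 3.2 (iv) p. 71; IUTchIII Thm. 3.11 (i) (Ind2) p. 154, Cor. 3.12 Step (xi-f) p. 184; IUTchIV Prop. 1.4 (ii) p. 13] [cite: NeukirchANT1999, Ch. II (5.5)]
[cite: DupuyHilado2025, §3.3, §3.4, §3.9, §4.9] [cite: WeilBNT1967, Ch. II §2, Th. 1] [claim: Mochizuki2012, status: disputed]. 0 sorry; standard axioms.
-/

noncomputable section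

open Set Metric Function NumberField IsDedekindDomain
open scoped Pointwise

namespace Summit.ABC.IUTFork.Repair.RH.LinearReachLaw

open Literature.IUT.LogVolume Literature.NumberTheory.GaloisRepresentations.Ultrametric

/-! ## §0. The inner conductor is at least `1`, and is witnessed one step below -/

section Lattice

variable (p : ℕ) [hp : Fact p.Prime] {K : Type*} [NontriviallyNormedField K] [instK : NormedAlgebra ℚ_[p] K] [IsUltrametricDist K]
  [ProperSpace K]

include hp instK in
/-- **`c ≥ 1`**: the unit ball is NOT inside `log_p(𝒪_K^×)` (abc-iut-rh-typ-12 `RHSlotReach.exists_norm_le_one_not_mem_logUnits`, [IUTchIV]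
Prop. 1.4 (ii): `μ(log_p 𝒪^×) < μ(𝒪)`), so the exponent `0` does not qualify. [cite: Mochizuki2012, IUTchIV Prop. 1.4 (ii) p. 13] -/
theorem one_le_of_isInnerConductor {ϖ : Kˣ} {c : ℕ} (hc : IsInnerConductor K ϖ c) : 1 ≤ c := by
  by_contra h
  have hc0 : c = 0 := by omega
  obtain ⟨u, hu, hu'⟩ := RHSlotReach.exists_norm_le_one_not_mem_logUnits p K
  refine hu' (hc.1 ?_)
  rw [mem_closedBall_zero_iff, hc0, pow_zero]
  exact hu

include hp instK in
/-- **The inner conductor's minimality, as a witness**: some `y ∉ log_p(𝒪_K^×)` has `‖y‖ ≤ ‖ϖ‖^{c−1}` (the ball one step below the conductor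
is not inside the lattice). This is the `hy`/`hyc` input of abc-iut-rp-d3's box-free door. [cite: NeukirchANT1999, Ch. II (5.5)] -/
theorem exists_not_mem_logUnits_of_isInnerConductor {ϖ : Kˣ} {c : ℕ} (hc : IsInnerConductor K ϖ c) :
    ∃ y : K, y ∉ logUnits K ∧ ‖y‖ ≤ ‖(ϖ : K)‖ ^ ((c : ℤ) - 1) := by
  have h1 : 1 ≤ c := one_le_of_isInnerConductor p hc
  have hnot : ¬ closedBall (0 : K) (‖(ϖ : K)‖ ^ (c - 1)) ⊆ logUnits K := fun h => by
    have := hc.2 (c - 1) h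
    omega
  obtain ⟨y, hy, hy'⟩ := Set.not_subset.1 hnot
  refine ⟨y, hy', ?_⟩
  rw [mem_closedBall_zero_iff] at hy
  rwa [← zpow_natCast, Nat.cast_sub h1, Nat.cast_one] at hy

end Lattice

/-! ## §1. The door at a one-place bad packet of a pilot datum, for realising ideles -/

section Setting

open Thm311 Thm311.Real Cor312 Cor312.Setting Cor312Vol Cor312Prov Literature.IUT.LogThetaLattice
open Literature.NumberTheory.NumberFields Summit.ABC.IUTFork.Repair.RH.ShellCapacityPlus Summit.ABC.IUTFork.Repair.RHLevelMover

variable {F : Type} [Field F] [NumberField F] (X : PilotData F) {logv : PadicLogs F} (hlog : LogvAnalytic logv)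
  (M : Type) [Field M] [NumberField M]
  (archPk : ∀ (j : (thetaIndex X).Label) (vQ : (thetaIndex X).VQ), Set ((logShellsDH X logv).Packet j vQ))
  (archSub : ∀ (j : (thetaIndex X).Label) (v : (thetaIndex X).V),
    Set ((logShellsDH X logv).Packet j ((thetaIndex X).over v)))
  (Ψ : ℤ → ∀ v : (thetaIndex X).V, v ∈ (thetaIndex X).Vbad → Set ((logShellsDH X logv).StarPacket v))
  (act : ℤ → ∀ v : (thetaIndex X).V, v ∈ (thetaIndex X).Vbad →
    (logShellsDH X logv).StarPacket v → Module.End ℚ ((logShellsDH X logv).StarPacket v))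
  (Mmod : ℤ → ∀ j : (thetaIndex X).LabelStar, Set ((logShellsDH X logv).GlobalPacket j.1))
  (region : ℤ → ∀ j : (thetaIndex X).LabelStar, FinDivisor M → ∀ vQ : (thetaIndex X).VQ,
    Set ((logShellsDH X logv).Packet j.1 vQ))
  (n : ℤ) {HT : Type} {LogLink : HT → HT → Type} {IsFull : ∀ {s t : HT}, LogLink s t → Prop}
  (lat : LGPGaussianLogThetaLattice LogLink IsFull)
  {Frd : Type} {IsoF : Frd → Frd → Type} {Ob : Frd → Type} {realify : Frd → Frd} {Strip : Type}
  {IsoS : Strip → Strip → Type} {Mv : ∀ v : (thetaIndex X).V, v ∈ (thetaIndex X).Vbad → Type}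
  [∀ v h, Monoid (Mv v h)]
  (sig : GlobalLGPFrobenioidSignature (thetaIndex X).lstar (thetaIndex X).V (· ∈ (thetaIndex X).Vbad)
    Frd IsoF Ob realify Strip IsoS Mv)
  (split : SplittingMonoids Mv) {ObΔ : Type} {N : ∀ v : (thetaIndex X).V, v ∈ (thetaIndex X).Vbad → Type}
  [∀ v h, Monoid (N v h)] (qData : QPilotData ObΔ N)
  (tq : ∀ (pp : Nat.Primes) (x : (thetaIndex X).Fibre (.inr pp)), haveI : Fact (pp : ℕ).Prime := ⟨pp.2⟩; kOf X pp.1 x)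
  (t : ∀ (pp : Nat.Primes) (_ : Fin X.lstar) (x : (thetaIndex X).Fibre (.inr pp)),
    haveI : Fact (pp : ℕ).Prime := ⟨pp.2⟩; kOf X pp.1 x)
  (htq0 : ∀ pp x, tq pp x ≠ 0)
  (htq1 : ∀ (pp : Nat.Primes) (x : (thetaIndex X).Fibre (.inr pp)),
    haveI : Fact (pp : ℕ).Prime := ⟨pp.2⟩; placeOf X pp.1 x ∉ X.S → ‖tq pp x‖ = 1)
  (ht0 : ∀ pp i x, t pp i x ≠ 0)
  -- the HONEST realising side conditions of the `K`-level certificates (`Cor312Prov.exists_realising_*_of_twoMulLDvdOrdq`)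
  (ht : ∀ (pp : Nat.Primes) (i : Fin X.lstar) (x : (thetaIndex X).Fibre (.inr pp)),
    haveI : Fact (pp : ℕ).Prime := ⟨pp.2⟩
    Real.log ‖t pp i x‖ = -(X.thetaPilot i (placeOf X pp.1 x)) * logNorm F (placeOf X pp.1 x) /
      localDegree F (placeOf X pp.1 x))
  (htq : ∀ (pp : Nat.Primes) (x : (thetaIndex X).Fibre (.inr pp)),
    haveI : Fact (pp : ℕ).Prime := ⟨pp.2⟩
    Real.log ‖tq pp x‖ = -(X.qPilot (placeOf X pp.1 x)) * logNorm F (placeOf X pp.1 x) /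
      localDegree F (placeOf X pp.1 x))

include ht0 ht htq in
/-- **ROW 20's EXACT CELL ⟹ `qRegion (i+1) p ⊆ thetaHull (i+1) p`, at a prime carrying a UNIQUE place which is bad, for REALISING ideles.**
`CellReachAt X p i x₀` quantifies over every norm uniformizer `ϖ` and THE two lattice integers `c, B` of `log_p(𝒪_{x₀}^×)`; instantiate them
(`Thm311.Real.unifOf`, `exists_isInnerConductor`, `exists_isOuterOrder`), read `m = ord_{x₀}(q)/2l` off `2l ∣ ord_{x₀}(q)` (`reachCell2l_iff`), the two
realising norms off the honest side conditions (`EvalI06StarGenuine.norm_qIdele_eq_rpow_of_realises` / `norm_thetaIdele_eq_rpow_of_realises`), the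
non-member `y` one step below the conductor (§0) and the extremal member `z` of the outer order, and apply abc-iut-rp-d3's box-free door
`RHLevelMover.qRegion_subset_thetaHull_settingPrVolSharp_of_reachCell`. [cite: Mochizuki2012, IUTchI Ex. 3.2 (iv) p. 71; IUTchIII Cor. 3.12 Step (xi-f) p. 184]
[cite: DupuyHilado2025, §3.9, §4.9] [cite: WeilBNT1967, Ch. II §2, Th. 1] [claim: Mochizuki2012, status: disputed] -/
theorem qRegion_subset_thetaHull_settingPrVolSharp_of_cellReachAt
    (pp : Nat.Primes) (x₀ : (thetaIndex X).Fibre (.inr pp)) (huniq : ∀ x : (thetaIndex X).Fibre (.inr pp), x = x₀)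
    (i : Fin X.lstar) (hx : haveI : Fact (pp : ℕ).Prime := ⟨pp.2⟩; placeOf X pp.1 x₀ ∈ X.S)
    (hdiv : haveI : Fact (pp : ℕ).Prime := ⟨pp.2⟩; (2 * (X.l : ℤ)) ∣ X.ordq (placeOf X pp.1 x₀))
    (hcell : CellReachAt X pp i x₀) :
    (settingPrVolSharp X hlog M archPk archSub Ψ act Mmod region n lat sig split qData tq t htq0 htq1).qRegion (Setting.labelSucc i)
        (.inr pp) ⊆
      (settingPrVolSharp X hlog M archPk archSub Ψ act Mmod region n lat sig split qData tq t htq0 htq1).thetaHull (Setting.labelSucc i)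
        (.inr pp) := by
  haveI hpF : Fact (pp : ℕ).Prime := ⟨pp.2⟩
  classical
  have hp0 : (0 : ℝ) < (pp : ℕ) := by exact_mod_cast pp.2.pos
  have hl : 0 < X.l := by have := X.five_le_l; omega
  have h2l0 : (2 : ℝ) * (X.l : ℝ) ≠ 0 := X.two_mul_l_pos.ne'
  -- the ramification index `e = e(x₀|p)` of the unique place
  have he1 : 1 ≤ (placeOf X pp.1 x₀).asIdeal.ramificationIdx ℤ := Ideal.ramificationIdx_pos _ _
  -- a norm uniformizer of `K_{x₀}` and its norm `p^{-1/e}`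
  have hϖ : IsUniformizer (unifOf X pp.1 x₀) :=
    (exists_isUniformizer_rescaledCompletion F pp.1 (placeOf X pp.1 x₀) (natCast_mem_placeOf X pp.1 x₀)).choose_spec.1
  have hϖn : ‖(unifOf X pp.1 x₀ : kOf X pp.1 x₀)‖ =
      ((pp : ℕ) : ℝ) ^ (-(1 : ℝ) / ((placeOf X pp.1 x₀).asIdeal.ramificationIdx ℤ : ℝ)) := by
    rw [norm_unifOf X pp.1 x₀, neg_div]
  have hϖzpow : ∀ m : ℤ, ‖(unifOf X pp.1 x₀ : kOf X pp.1 x₀)‖ ^ m =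
      ((pp : ℕ) : ℝ) ^ (-(m : ℝ) / ((placeOf X pp.1 x₀).asIdeal.ramificationIdx ℤ : ℝ)) := by
    intro m; rw [← Real.rpow_intCast, hϖn, ← Real.rpow_mul hp0.le]; congr 1; ring
  -- THE two lattice integers of `log_p(𝒪_{x₀}^×)` and their witnesses
  obtain ⟨c, hc⟩ := exists_isInnerConductor (pp : ℕ) hϖ
  obtain ⟨B, hB⟩ := exists_isOuterOrder (pp : ℕ) hϖ
  obtain ⟨y, hy, hyc⟩ := exists_not_mem_logUnits_of_isInnerConductor (pp : ℕ) hc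
  obtain ⟨z, hz, hzB⟩ := hB.2
  -- the integer `q`-depth `m = ord_{x₀}(q) / 2l` and the exact cell in the author's form
  obtain ⟨m, hm⟩ := hdiv
  have hcell' : ReachCell ((placeOf X pp.1 x₀).asIdeal.ramificationIdx ℤ : ℤ) (c : ℤ) B ((i : ℕ) + 1) m :=
    (reachCell2l_iff hl hm).1 (hcell _ hϖ c B hc hB)
  have hmR : (X.ordq (placeOf X pp.1 x₀) : ℝ) = 2 * (X.l : ℝ) * (m : ℝ) := by exact_mod_cast hm
  -- the realising norms as uniformizer powers (honest side conditions)
  have hq : ‖tq pp x₀‖ = ‖(unifOf X pp.1 x₀ : kOf X pp.1 x₀)‖ ^ m := by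
    rw [hϖzpow, EvalI06StarGenuine.norm_qIdele_eq_rpow_of_realises X tq htq0 htq pp x₀ hx, hmR]
    congr 1; rw [mul_div_mul_left _ _ h2l0, neg_div]
  have hΘ : ‖t pp i x₀‖ = ‖(unifOf X pp.1 x₀ : kOf X pp.1 x₀)‖ ^ ((((i : ℕ) + 1 : ℕ) : ℤ) ^ 2 * m) := by
    rw [hϖzpow, EvalI06StarGenuine.norm_thetaIdele_eq_rpow_of_realises X t ht tq htq0 htq pp i x₀ hx, hmR]
    congr 1; rw [mul_div_mul_left _ _ h2l0]; push_cast; ring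
  -- the unique place is a finite place `v₀`; apply abc-iut-rp-d3's box-free door there
  obtain ⟨v, hv⟩ := x₀
  rcases v with w | v₀
  · exact absurd hv (by simp [thetaIndex])
  · exact qRegion_subset_thetaHull_settingPrVolSharp_of_reachCell X hlog M archPk archSub Ψ act Mmod region n lat sig split qData tq t
      htq0 htq1 ht0 pp v₀ hv huniq i _ c he1 B m hϖn hy hyc hz hzB.symm.le hq hΘ hcell'

include ht0 ht htq in
/-- **H⋆₂₀'s (envelope) cell ⟹ the inclusion** at a one-place bad packet, for realising ideles (`cellReachAt_of_cellAt` then §1). [claim: Mochizuki2012, status: disputed] -/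
theorem qRegion_subset_thetaHull_settingPrVolSharp_of_cellAt
    (pp : Nat.Primes) (x₀ : (thetaIndex X).Fibre (.inr pp)) (huniq : ∀ x : (thetaIndex X).Fibre (.inr pp), x = x₀)
    (i : Fin X.lstar) (hx : haveI : Fact (pp : ℕ).Prime := ⟨pp.2⟩; placeOf X pp.1 x₀ ∈ X.S)
    (hdiv : haveI : Fact (pp : ℕ).Prime := ⟨pp.2⟩; (2 * (X.l : ℤ)) ∣ X.ordq (placeOf X pp.1 x₀))
    (hcell : CellAt X pp i x₀) :
    (settingPrVolSharp X hlog M archPk archSub Ψ act Mmod region n lat sig split qData tq t htq0 htq1).qRegion (Setting.labelSucc i)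
        (.inr pp) ⊆
      (settingPrVolSharp X hlog M archPk archSub Ψ act Mmod region n lat sig split qData tq t htq0 htq1).thetaHull (Setting.labelSucc i)
        (.inr pp) :=
  haveI : Fact (pp : ℕ).Prime := ⟨pp.2⟩
  qRegion_subset_thetaHull_settingPrVolSharp_of_cellReachAt X hlog M archPk archSub Ψ act Mmod region n lat sig split qData tq t htq0
    htq1 ht0 ht htq pp x₀ huniq i hx hdiv (cellReachAt_of_cellAt X pp i _ hcell)

include ht0 ht htq in
/-- **`HStarReach X` ⟹ the inclusion at EVERY one-place bad packet** (the exact candidate read at the datum; realising ideles, `2l ∣ ord(q)` at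
the place). The stratum served is exactly «one-place bad packets» — packet-local, as round 2's «S_H|Σ through a landed door» wants it.
[cite: Mochizuki2012, IUTchIII Cor. 3.12 Step (xi-f) p. 184] [claim: Mochizuki2012, status: disputed] -/
theorem qRegion_subset_thetaHull_settingPrVolSharp_of_hStarReach (hH : HStarReach X)
    (pp : Nat.Primes) (x₀ : (thetaIndex X).Fibre (.inr pp)) (huniq : ∀ x : (thetaIndex X).Fibre (.inr pp), x = x₀)
    (i : Fin X.lstar) (hx : haveI : Fact (pp : ℕ).Prime := ⟨pp.2⟩; placeOf X pp.1 x₀ ∈ X.S)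
    (hdiv : haveI : Fact (pp : ℕ).Prime := ⟨pp.2⟩; (2 * (X.l : ℤ)) ∣ X.ordq (placeOf X pp.1 x₀)) :
    (settingPrVolSharp X hlog M archPk archSub Ψ act Mmod region n lat sig split qData tq t htq0 htq1).qRegion (Setting.labelSucc i)
        (.inr pp) ⊆
      (settingPrVolSharp X hlog M archPk archSub Ψ act Mmod region n lat sig split qData tq t htq0 htq1).thetaHull (Setting.labelSucc i)
        (.inr pp) :=
  haveI : Fact (pp : ℕ).Prime := ⟨pp.2⟩
  qRegion_subset_thetaHull_settingPrVolSharp_of_cellReachAt X hlog M archPk archSub Ψ act Mmod region n lat sig split qData tq t htq0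
    htq1 ht0 ht htq pp x₀ huniq i hx hdiv (hH pp i _ hx)

include ht0 ht htq in
/-- **`HStar X` (H⋆₂₀ itself) ⟹ the inclusion at EVERY one-place bad packet** (realising ideles, `2l ∣ ord(q)` at the place). [claim: Mochizuki2012, status: disputed] -/
theorem qRegion_subset_thetaHull_settingPrVolSharp_of_hStar (hH : HStar X)
    (pp : Nat.Primes) (x₀ : (thetaIndex X).Fibre (.inr pp)) (huniq : ∀ x : (thetaIndex X).Fibre (.inr pp), x = x₀)
    (i : Fin X.lstar) (hx : haveI : Fact (pp : ℕ).Prime := ⟨pp.2⟩; placeOf X pp.1 x₀ ∈ X.S)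
    (hdiv : haveI : Fact (pp : ℕ).Prime := ⟨pp.2⟩; (2 * (X.l : ℤ)) ∣ X.ordq (placeOf X pp.1 x₀)) :
    (settingPrVolSharp X hlog M archPk archSub Ψ act Mmod region n lat sig split qData tq t htq0 htq1).qRegion (Setting.labelSucc i)
        (.inr pp) ⊆
      (settingPrVolSharp X hlog M archPk archSub Ψ act Mmod region n lat sig split qData tq t htq0 htq1).thetaHull (Setting.labelSucc i)
        (.inr pp) :=
  qRegion_subset_thetaHull_settingPrVolSharp_of_hStarReach X hlog M archPk archSub Ψ act Mmod region n lat sig split qData tq t htq0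
    htq1 ht0 ht htq (hStarReach_of_hStar X hH) pp x₀ huniq i hx hdiv

include ht0 ht htq in
/-- **The same with the divisibility BY NAME**: under `Cor312Prov.TwoMulLDvdOrdq X` («`2l ∣ ord_w(q_w)` at every `w ∈ S`», [IUTchI] Ex. 3.2 (iv);
EQUIVALENT to the existence of realising `q`-ideles, and a theorem at the genuine datum — §2), `HStarReach X` gives the inclusion at every
one-place bad packet. [cite: Mochizuki2012, IUTchI Ex. 3.2 (iv) p. 71] [claim: Mochizuki2012, status: disputed] -/
theorem qRegion_subset_thetaHull_settingPrVolSharp_of_hStarReach_of_twoMulLDvdOrdq (hK : TwoMulLDvdOrdq X) (hH : HStarReach X)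
    (pp : Nat.Primes) (x₀ : (thetaIndex X).Fibre (.inr pp)) (huniq : ∀ x : (thetaIndex X).Fibre (.inr pp), x = x₀)
    (i : Fin X.lstar) (hx : haveI : Fact (pp : ℕ).Prime := ⟨pp.2⟩; placeOf X pp.1 x₀ ∈ X.S) :
    (settingPrVolSharp X hlog M archPk archSub Ψ act Mmod region n lat sig split qData tq t htq0 htq1).qRegion (Setting.labelSucc i)
        (.inr pp) ⊆
      (settingPrVolSharp X hlog M archPk archSub Ψ act Mmod region n lat sig split qData tq t htq0 htq1).thetaHull (Setting.labelSucc i)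
        (.inr pp) :=
  haveI : Fact (pp : ℕ).Prime := ⟨pp.2⟩
  qRegion_subset_thetaHull_settingPrVolSharp_of_hStarReach X hlog M archPk archSub Ψ act Mmod region n lat sig split qData tq t htq0
    htq1 ht0 ht htq hH pp x₀ huniq i hx (hK _ hx)

end Setting

/-! ## §2. At print's own `K`-level pilot datum `Cor312Prov.pilotDataOfK D K`: the divisibility discharged -/

section Genuine

open Thm311 Thm311.Real Cor312 Cor312.Setting Cor312Vol Cor312Prov Literature.IUT.LogThetaLattice Literature.IUT.HodgeTheaters
open Literature.NumberTheory.NumberFields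

variable {F K Fbar : Type} [Field F] [NumberField F] [Field K] [NumberField K] [Algebra F K] [Field Fbar]
  [Algebra F Fbar] [Algebra K Fbar] {E : WeierstrassCurve F} [E.IsElliptic] {l : ℕ} {Pb : BadPlacePredicates K}
  (D : InitialThetaData F K Fbar E l Pb)
  {logv : PadicLogs K} (hlog : LogvAnalytic logv) (M : Type) [Field M] [NumberField M]
  (archPk : ∀ (j : (thetaIndex (pilotDataOfK D K)).Label) (vQ : (thetaIndex (pilotDataOfK D K)).VQ),
    Set ((logShellsDH (pilotDataOfK D K) logv).Packet j vQ))
  (archSub : ∀ (j : (thetaIndex (pilotDataOfK D K)).Label) (v : (thetaIndex (pilotDataOfK D K)).V),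
    Set ((logShellsDH (pilotDataOfK D K) logv).Packet j ((thetaIndex (pilotDataOfK D K)).over v)))
  (Ψ : ℤ → ∀ v : (thetaIndex (pilotDataOfK D K)).V, v ∈ (thetaIndex (pilotDataOfK D K)).Vbad →
    Set ((logShellsDH (pilotDataOfK D K) logv).StarPacket v))
  (act : ℤ → ∀ v : (thetaIndex (pilotDataOfK D K)).V, v ∈ (thetaIndex (pilotDataOfK D K)).Vbad →
    (logShellsDH (pilotDataOfK D K) logv).StarPacket v → Module.End ℚ ((logShellsDH (pilotDataOfK D K) logv).StarPacket v))
  (Mmod : ℤ → ∀ j : (thetaIndex (pilotDataOfK D K)).LabelStar, Set ((logShellsDH (pilotDataOfK D K) logv).GlobalPacket j.1))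
  (region : ℤ → ∀ j : (thetaIndex (pilotDataOfK D K)).LabelStar, FinDivisor M → ∀ vQ : (thetaIndex (pilotDataOfK D K)).VQ,
    Set ((logShellsDH (pilotDataOfK D K) logv).Packet j.1 vQ))
  (n : ℤ) {HT : Type} {LogLink : HT → HT → Type} {IsFull : ∀ {s t : HT}, LogLink s t → Prop}
  (lat : LGPGaussianLogThetaLattice LogLink IsFull)
  {Frd : Type} {IsoF : Frd → Frd → Type} {Ob : Frd → Type} {realify : Frd → Frd} {Strip : Type}
  {IsoS : Strip → Strip → Type} {Mv : ∀ v : (thetaIndex (pilotDataOfK D K)).V, v ∈ (thetaIndex (pilotDataOfK D K)).Vbad → Type}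
  [∀ v h, Monoid (Mv v h)]
  (sig : GlobalLGPFrobenioidSignature (thetaIndex (pilotDataOfK D K)).lstar (thetaIndex (pilotDataOfK D K)).V
    (· ∈ (thetaIndex (pilotDataOfK D K)).Vbad) Frd IsoF Ob realify Strip IsoS Mv)
  (split : SplittingMonoids Mv) {ObΔ : Type} {N : ∀ v : (thetaIndex (pilotDataOfK D K)).V, v ∈ (thetaIndex (pilotDataOfK D K)).Vbad → Type}
  [∀ v h, Monoid (N v h)] (qData : QPilotData ObΔ N)
  (tq : ∀ (pp : Nat.Primes) (x : (thetaIndex (pilotDataOfK D K)).Fibre (.inr pp)),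
    haveI : Fact (pp : ℕ).Prime := ⟨pp.2⟩; kOf (pilotDataOfK D K) pp.1 x)
  (t : ∀ (pp : Nat.Primes) (_ : Fin (pilotDataOfK D K).lstar) (x : (thetaIndex (pilotDataOfK D K)).Fibre (.inr pp)),
    haveI : Fact (pp : ℕ).Prime := ⟨pp.2⟩; kOf (pilotDataOfK D K) pp.1 x)
  (htq0 : ∀ pp x, tq pp x ≠ 0)
  (htq1 : ∀ (pp : Nat.Primes) (x : (thetaIndex (pilotDataOfK D K)).Fibre (.inr pp)),
    haveI : Fact (pp : ℕ).Prime := ⟨pp.2⟩; placeOf (pilotDataOfK D K) pp.1 x ∉ (pilotDataOfK D K).S → ‖tq pp x‖ = 1)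
  (ht0 : ∀ pp i x, t pp i x ≠ 0)
  (ht : ∀ (pp : Nat.Primes) (i : Fin (pilotDataOfK D K).lstar) (x : (thetaIndex (pilotDataOfK D K)).Fibre (.inr pp)),
    haveI : Fact (pp : ℕ).Prime := ⟨pp.2⟩
    Real.log ‖t pp i x‖ = -((pilotDataOfK D K).thetaPilot i (placeOf (pilotDataOfK D K) pp.1 x)) *
      logNorm K (placeOf (pilotDataOfK D K) pp.1 x) / localDegree K (placeOf (pilotDataOfK D K) pp.1 x))
  (htq : ∀ (pp : Nat.Primes) (x : (thetaIndex (pilotDataOfK D K)).Fibre (.inr pp)),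
    haveI : Fact (pp : ℕ).Prime := ⟨pp.2⟩
    Real.log ‖tq pp x‖ = -((pilotDataOfK D K).qPilot (placeOf (pilotDataOfK D K) pp.1 x)) *
      logNorm K (placeOf (pilotDataOfK D K) pp.1 x) / localDegree K (placeOf (pilotDataOfK D K) pp.1 x))

include ht0 ht htq in
/-- **AT THE GENUINE `K`-LEVEL DATUM, the exact cell ⟹ the inclusion** at a one-place bad packet, for realising ideles — `2l ∣ ord_w(q)` is a
THEOREM there (`Cor312Prov.twoMulLDvdOrdq_pilotDataOfK`, [IUTchI] Ex. 3.2 (iv)), so the only inputs are the cell, the unique place and the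
honest side conditions. [cite: Mochizuki2012, IUTchI Ex. 3.2 (iv) p. 71; IUTchIII Cor. 3.12 Step (xi-f) p. 184] [claim: Mochizuki2012, status: disputed] -/
theorem qRegion_subset_thetaHull_settingPrVolSharp_pilotDataOfK_of_cellReachAt
    (pp : Nat.Primes) (x₀ : (thetaIndex (pilotDataOfK D K)).Fibre (.inr pp))
    (huniq : ∀ x : (thetaIndex (pilotDataOfK D K)).Fibre (.inr pp), x = x₀) (i : Fin (pilotDataOfK D K).lstar)
    (hx : haveI : Fact (pp : ℕ).Prime := ⟨pp.2⟩; placeOf (pilotDataOfK D K) pp.1 x₀ ∈ (pilotDataOfK D K).S)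
    (hcell : CellReachAt (pilotDataOfK D K) pp i x₀) :
    (settingPrVolSharp (pilotDataOfK D K) hlog M archPk archSub Ψ act Mmod region n lat sig split qData tq t htq0 htq1).qRegion
        (Setting.labelSucc i) (.inr pp) ⊆
      (settingPrVolSharp (pilotDataOfK D K) hlog M archPk archSub Ψ act Mmod region n lat sig split qData tq t htq0 htq1).thetaHull
        (Setting.labelSucc i) (.inr pp) :=
  haveI : Fact (pp : ℕ).Prime := ⟨pp.2⟩
  qRegion_subset_thetaHull_settingPrVolSharp_of_cellReachAt (pilotDataOfK D K) hlog M archPk archSub Ψ act Mmod region n lat sig split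
    qData tq t htq0 htq1 ht0 ht htq pp x₀ huniq i hx (twoMulLDvdOrdq_pilotDataOfK D _ hx) hcell

include ht0 ht htq in
/-- **AT THE GENUINE `K`-LEVEL DATUM, `HStarReach` ⟹ the inclusion at every one-place bad packet**, for realising ideles.
[cite: Mochizuki2012, IUTchI Ex. 3.2 (iv) p. 71; IUTchIII Cor. 3.12 Step (xi-f) p. 184] [claim: Mochizuki2012, status: disputed] -/
theorem qRegion_subset_thetaHull_settingPrVolSharp_pilotDataOfK_of_hStarReach (hH : HStarReach (pilotDataOfK D K))
    (pp : Nat.Primes) (x₀ : (thetaIndex (pilotDataOfK D K)).Fibre (.inr pp))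
    (huniq : ∀ x : (thetaIndex (pilotDataOfK D K)).Fibre (.inr pp), x = x₀) (i : Fin (pilotDataOfK D K).lstar)
    (hx : haveI : Fact (pp : ℕ).Prime := ⟨pp.2⟩; placeOf (pilotDataOfK D K) pp.1 x₀ ∈ (pilotDataOfK D K).S) :
    (settingPrVolSharp (pilotDataOfK D K) hlog M archPk archSub Ψ act Mmod region n lat sig split qData tq t htq0 htq1).qRegion
        (Setting.labelSucc i) (.inr pp) ⊆
      (settingPrVolSharp (pilotDataOfK D K) hlog M archPk archSub Ψ act Mmod region n lat sig split qData tq t htq0 htq1).thetaHull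
        (Setting.labelSucc i) (.inr pp) :=
  qRegion_subset_thetaHull_settingPrVolSharp_of_hStarReach_of_twoMulLDvdOrdq (pilotDataOfK D K) hlog M archPk archSub Ψ act Mmod region
    n lat sig split qData tq t htq0 htq1 ht0 ht htq (twoMulLDvdOrdq_pilotDataOfK D) hH pp x₀ huniq i hx

include ht0 ht htq in
/-- **AT THE GENUINE `K`-LEVEL DATUM, H⋆₂₀ = `HStar (pilotDataOfK D K)` ⟹ the inclusion at every one-place bad packet**, for realising ideles —
row 20's round-2 kernel link «H⋆₂₀ ⟹ hull» at the deciding declaration of record. [cite: Mochizuki2012, IUTchI Ex. 3.2 (iv) p. 71;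
IUTchIII Cor. 3.12 Step (xi-f) p. 184] [claim: Mochizuki2012, status: disputed] -/
theorem qRegion_subset_thetaHull_settingPrVolSharp_pilotDataOfK_of_hStar (hH : HStar (pilotDataOfK D K))
    (pp : Nat.Primes) (x₀ : (thetaIndex (pilotDataOfK D K)).Fibre (.inr pp))
    (huniq : ∀ x : (thetaIndex (pilotDataOfK D K)).Fibre (.inr pp), x = x₀) (i : Fin (pilotDataOfK D K).lstar)
    (hx : haveI : Fact (pp : ℕ).Prime := ⟨pp.2⟩; placeOf (pilotDataOfK D K) pp.1 x₀ ∈ (pilotDataOfK D K).S) :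
    (settingPrVolSharp (pilotDataOfK D K) hlog M archPk archSub Ψ act Mmod region n lat sig split qData tq t htq0 htq1).qRegion
        (Setting.labelSucc i) (.inr pp) ⊆
      (settingPrVolSharp (pilotDataOfK D K) hlog M archPk archSub Ψ act Mmod region n lat sig split qData tq t htq0 htq1).thetaHull
        (Setting.labelSucc i) (.inr pp) :=
  qRegion_subset_thetaHull_settingPrVolSharp_pilotDataOfK_of_hStarReach D hlog M archPk archSub Ψ act Mmod region n lat sig split qData tq
    t htq0 htq1 ht0 ht htq (hStarReach_of_hStar _ hH) pp x₀ huniq i hx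

end Genuine

/-! ## §3. Σ₂₀ decided at the genuine bed: the exact cell at `pilotDataOfK D K` in the column currency (untied rows) -/

section GenuineCells

open Thm311 Thm311.Real Cor312 Cor312Vol Cor312Prov Literature.IUT.HodgeTheaters

variable {F K Fbar : Type} [Field F] [NumberField F] [Field K] [NumberField K] [Algebra F K] [Field Fbar]
  [Algebra F Fbar] [Algebra K Fbar] {E : WeierstrassCurve F} [E.IsElliptic] {l : ℕ} {Pb : BadPlacePredicates K}
  (D : InitialThetaData F K Fbar E l Pb)

/-- **Σ₂₀ AS INTEGER CELLS AT THE GENUINE BED (untied rows)**: at a bad place `x | p` of `K` over `v ∈ 𝕍(F)^bad` with `(p−1) ∤ e_x` and strict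
turning point `a₀`, the EXACT cell at label `i+1` holds IFF `ReachCell2l e_x r_in_ub r_out_sharp (i+1) (e(x|v)·ord_v(q_v)) l`
(`ord_x(q) = e(x|v)·ord_v(q_v)`, `Cor312Prov.ordq_pilotDataOfK`; the exact twin of `cellAt_pilotDataOfK_iff_col_of_not_dvd`). So the stratum
served by §2 is decidable row by row on I06STAR-COLUMNS / the genuine bed. [cite: Mochizuki2012, IUTchI Def. 3.1 (c) p. 61]
[cite: NeukirchANT1999, Ch. II (5.5)] [claim: Mochizuki2012, status: disputed] -/
theorem cellReachAt_pilotDataOfK_iff_col_of_not_dvd (pp : Nat.Primes) [Fact (pp : ℕ).Prime] (i : Fin (pilotDataOfK D K).lstar)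
    (x : (thetaIndex (pilotDataOfK D K)).Fibre (.inr pp)) (hx : placeOf (pilotDataOfK D K) pp.1 x ∈ (pilotDataOfK D K).S)
    (hnd : ¬ ((pp : ℕ) - 1 ∣ (placeOf (pilotDataOfK D K) pp.1 x).asIdeal.ramificationIdx ℤ)) {a₀ : ℕ}
    (hlo : ∀ a < a₀, ((pp : ℕ) : ℤ) ^ a * (((pp : ℕ) : ℤ) - 1) < (placeOf (pilotDataOfK D K) pp.1 x).asIdeal.ramificationIdx ℤ)
    (hhi : ((placeOf (pilotDataOfK D K) pp.1 x).asIdeal.ramificationIdx ℤ : ℤ) < ((pp : ℕ) : ℤ) ^ a₀ * (((pp : ℕ) : ℤ) - 1)) :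
    CellReachAt (pilotDataOfK D K) pp i x ↔
      ReachCell2l ((placeOf (pilotDataOfK D K) pp.1 x).asIdeal.ramificationIdx ℤ : ℤ)
        (((placeOf (pilotDataOfK D K) pp.1 x).asIdeal.ramificationIdx ℤ / ((pp : ℕ) - 1) + 1 : ℕ) : ℤ)
        (((pp : ℕ) : ℤ) ^ a₀ - ((placeOf (pilotDataOfK D K) pp.1 x).asIdeal.ramificationIdx ℤ : ℤ) * (a₀ : ℤ)) ((i : ℕ) + 1)
        (((finBelow F K (placeOf (pilotDataOfK D K) pp.1 x)).asIdeal.ramificationIdx'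
            (placeOf (pilotDataOfK D K) pp.1 x).asIdeal : ℤ) *
          (qParamOrd E (finBelow F K (placeOf (pilotDataOfK D K) pp.1 x)) : ℤ)) l := by
  rw [cellReachAt_iff_col_of_not_dvd (pilotDataOfK D K) pp i x hnd hlo hhi, ordq_pilotDataOfK D K hx, pilotDataOfK_l]

/-- **… and a column-NEG exact cell at the genuine datum refutes `HStarReach` there** (every `p`, `e_x`; ties included) — the packets OUTSIDE Σ₂₀.
[cite: Mochizuki2012, IUTchI Def. 3.1 (c) p. 61] [claim: Mochizuki2012, status: disputed] -/
theorem not_hStarReach_pilotDataOfK_of_not_col (pp : Nat.Primes) [Fact (pp : ℕ).Prime] (i : Fin (pilotDataOfK D K).lstar)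
    (x : (thetaIndex (pilotDataOfK D K)).Fibre (.inr pp)) (hx : placeOf (pilotDataOfK D K) pp.1 x ∈ (pilotDataOfK D K).S) {a₀ : ℕ}
    (hlo : ∀ a < a₀, ((pp : ℕ) : ℤ) ^ a * (((pp : ℕ) : ℤ) - 1) < (placeOf (pilotDataOfK D K) pp.1 x).asIdeal.ramificationIdx ℤ)
    (hhi : ((placeOf (pilotDataOfK D K) pp.1 x).asIdeal.ramificationIdx ℤ : ℤ) ≤ ((pp : ℕ) : ℤ) ^ a₀ * (((pp : ℕ) : ℤ) - 1))
    (hneg : ¬ ReachCell2l ((placeOf (pilotDataOfK D K) pp.1 x).asIdeal.ramificationIdx ℤ : ℤ)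
      (((placeOf (pilotDataOfK D K) pp.1 x).asIdeal.ramificationIdx ℤ / ((pp : ℕ) - 1) + 1 : ℕ) : ℤ)
      (((pp : ℕ) : ℤ) ^ a₀ - ((placeOf (pilotDataOfK D K) pp.1 x).asIdeal.ramificationIdx ℤ : ℤ) * (a₀ : ℤ)) ((i : ℕ) + 1)
      (((finBelow F K (placeOf (pilotDataOfK D K) pp.1 x)).asIdeal.ramificationIdx'
            (placeOf (pilotDataOfK D K) pp.1 x).asIdeal : ℤ) *
          (qParamOrd E (finBelow F K (placeOf (pilotDataOfK D K) pp.1 x)) : ℤ)) l) :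
    ¬ HStarReach (pilotDataOfK D K) := by
  refine not_hStarReach_of_not_cellReachAt (pilotDataOfK D K) pp i x hx (not_cellReachAt_of_not_col (pilotDataOfK D K) pp i x hlo hhi ?_)
  rwa [ordq_pilotDataOfK D K hx, pilotDataOfK_l]

end GenuineCells

end Summit.ABC.IUTFork.Repair.RH.LinearReachLaw

end
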